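import Literature.IUT.LogVolume.TameQuadraticPacketSlot
import Literature.IUT.LogVolume.TensorPacketLinearIsometry
import HarnessLib

/-!
# Isometries FIX the maximal order of EVERY packet `⊗_{i∈I} K` of the tame quadratic field `K = ℚ_p(π)`, `π² = p`, `p` odd

Classical local algebra (nothing disputed; the [IUTchIV] locator records where the abc-iut cell uses it).  Sequel to
`TameQuadraticIsometryStable.lean` (the two-factor packet `K ⊗ K`), removing its restriction to TWO factors: here `I` is ANY
finite index type, i.e. every label `j` (`|I| = j + 1`) of a summand `v⃗ ≡ w` at a prime with a single, tame quadratic, place.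
The proof is slot-by-slot and uses NO field-factor decomposition: for a slot `i₀`, every `z ∈ V = ⊗_{i∈I} K` is
`z = m₀ + ι_{i₀}(π)·m₁` with `m₀, m₁` in the span `L_{i₀}` of the pure tensors having `1` at `i₀`; the GALOIS CONJUGATION
`τ : π ↦ −π` of `K` (`exists_conj`), applied at the slot `i₀`, is a multiplicative isometric automorphism of `V` fixing `L_{i₀}` and
negating `ι_{i₀}(π)·L_{i₀}`, hence preserves `(R_I)^∼`; so `z ∈ (R_I)^∼ ⇒ m₀, ι_{i₀}(π)·m₁ ∈ (R_I)^∼` (`‖2‖ = 1`: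
`mem_normalizedPacket_decomp`).  A `ℚ_p`-linear ISOMETRY `σ` at the slot `i₀` acts by `σ 1 = a + bπ`, `σ π = c + dπ` with
`‖a‖ ≤ 1`, `‖b‖ ≤ 1`, `c ∈ p·ℤ_p`, `‖d‖ ≤ 1` (`TameQuadratic.isometry_coeff_bounds` + the value group of `ℚ_p`), and
`c·m₁ = (c/p)·ι(π)·(ι(π)·m₁)` — so it maps `(R_I)^∼` into itself (`congr_update_mem_normalizedPacket`); composing over the
slots:

* **`congr_mem_normalizedPacket_of_isometries`**, **`congr_image_normalizedPacket_eq_of_isometries`** — for `p` odd,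
  `[K : ℚ_p] = 2`, `π² = p` and EVERY family of `ℚ_p`-linear isometries `(f_i)_{i∈I}` of `K`: `(⊗ f_i)((R_I)^∼) = (R_I)^∼`;
* **`not_exists_isometry_mover_packet`** — no pair (isometries `f`, `z ∈ (R_I)^∼`) with `(⊗ f_i)(z) ∉ (R_I)^∼` exists, at ANY
  number of factors — the negation of the exhibit shape `hmove` of the cell's Y-29b reduction at every such summand;
* **`exists_tameQuadratic_packet_isometry_stable`** — NON-VACUITY inside `ℚ̄_p` (`E = ℚ_p(√p)`), every odd `p`, every finite `I`.

NOT covered: summands with factors at DIFFERENT places (mixed packets), the twist `π² = ε·p`, ramification index `e ≥ 3`.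
CONTAINERS only; no side is taken on [IUTchIII] Cor. 3.12.  Proof-only file (theorems, no definitions).
[cite: Mochizuki2012, IUTchIV Prop. 1.1 p. 9] [cite: NeukirchANT1999, Ch. II (5.5)]
-/

noncomputable section

open Metric Set Function
open scoped TensorProduct

namespace Literature.IUT.LogVolume

namespace TameQuadratic

variable {p : ℕ} [Fact p.Prime]
variable {K : Type} [NontriviallyNormedField K] [NormedAlgebra ℚ_[p] K] {π : K}
variable {I : Type} [DecidableEq I]

/-! ## Multiplicative isometric families preserve `(R_I)^∼`; the conjugation at one slot -/

omit [DecidableEq I] in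
/-- **A factorwise MULTIPLICATIVE family of isometries (`g_i(xy) = g_i(x)g_i(y)`, `g_i 1 = 1`, `‖g_i x‖ = ‖x‖`) maps
`(R_I)^∼` into itself**: `⊗ g_i` is then a ring automorphism of `V` mapping `R_I` onto itself
(`congr_image_integerPacket_of_norm_eq`), so it transports integrality over `R_I`. [cite: Mochizuki2012, IUTchIV Prop. 1.1 p. 9] -/
theorem congr_mem_normalizedPacket_of_mul [Nonempty I] (g : ∀ _ : I, K ≃ₗ[ℚ_[p]] K) (h1 : ∀ i, g i 1 = 1)
    (hmul : ∀ i x y, g i (x * y) = g i x * g i y) (hg : ∀ i x, ‖g i x‖ = ‖x‖)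
    {z : PacketAlgebra p (fun _ : I => K)} (hz : z ∈ normalizedPacket p (fun _ : I => K)) :
    (PiTensorProduct.congr g : PacketAlgebra p (fun _ : I => K) ≃ₗ[ℚ_[p]] PacketAlgebra p (fun _ : I => K)) z ∈
      normalizedPacket p (fun _ : I => K) := by
  set G : PacketAlgebra p (fun _ : I => K) ≃ₗ[ℚ_[p]] PacketAlgebra p (fun _ : I => K) := PiTensorProduct.congr g with hG
  -- `G` is multiplicative and unital
  have hG1 : G 1 = 1 := by
    rw [hG, ← purePacket_one, purePacket, PiTensorProduct.congr_tprod]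
    congr 1; funext i; exact h1 i
  have hGmul : ∀ x y, G (x * y) = G x * G y := by
    intro x y
    induction x using PiTensorProduct.induction_on with
    | smul_tprod r a =>
      induction y using PiTensorProduct.induction_on with
      | smul_tprod s b =>
        rw [smul_mul_smul_comm, map_smul, map_smul, map_smul, PiTensorProduct.tprod_mul_tprod, hG,
          PiTensorProduct.congr_tprod, PiTensorProduct.congr_tprod, PiTensorProduct.congr_tprod, smul_mul_smul_comm,
          PiTensorProduct.tprod_mul_tprod]
        congr 2; funext i; exact hmul i (a i) (b i)
      | add u v hu hv => rw [mul_add, map_add, hu, hv, map_add, mul_add]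
    | add u v hu hv => rw [add_mul, map_add, hu, hv, map_add, add_mul]
  let Φ : PacketAlgebra p (fun _ : I => K) →+* PacketAlgebra p (fun _ : I => K) :=
    { toFun := G, map_one' := hG1, map_mul' := hGmul, map_zero' := map_zero G, map_add' := map_add G }
  have hΦ : ∀ x, Φ x = G x := fun _ => rfl
  -- `Φ` maps `R_I` into `R_I`
  have hR : ∀ t ∈ integerPacket p (fun _ : I => K), Φ t ∈ integerPacket p (fun _ : I => K) := fun t ht => by
    rw [hΦ, hG]; exact congr_mem_integerPacket_of_norm_le p (fun _ : I => K) g (fun i x => (hg i x).le) ht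
  let φ : integerPacket p (fun _ : I => K) →+* integerPacket p (fun _ : I => K) := Φ.restrict _ _ hR
  have hcomp : (algebraMap (integerPacket p (fun _ : I => K)) (PacketAlgebra p (fun _ : I => K))).comp φ =
      Φ.comp (algebraMap (integerPacket p (fun _ : I => K)) (PacketAlgebra p (fun _ : I => K))) := by
    ext t; rfl
  have h := IsIntegral.map_of_comp_eq φ Φ hcomp ((mem_normalizedPacket_iff p (fun _ : I => K)).mp hz)
  exact (mem_normalizedPacket_iff p (fun _ : I => K)).mpr h

/-- `ℤ_p`-scalars preserve `(R_I)^∼`. [cite: Mochizuki2012, IUTchIV Prop. 1.1 p. 9] -/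
theorem smul_mem_normalizedPacket [Nonempty I] {r : ℚ_[p]} (hr : ‖r‖ ≤ 1) {z : PacketAlgebra p (fun _ : I => K)}
    (hz : z ∈ normalizedPacket p (fun _ : I => K)) : r • z ∈ normalizedPacket p (fun _ : I => K) := by
  rw [Algebra.smul_def]
  exact mul_mem (integerPacket_le_normalizedPacket p _ (algebraMap_mem_integerPacket p _ hr)) hz

/-- `ι_{i₀}(π) ∈ (R_I)^∼`. [cite: Mochizuki2012, IUTchIV Prop. 1.1 p. 9] -/
theorem iota_pi_mem_normalizedPacket (hπ : π ^ 2 = (p : K)) (i₀ : I) :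
    iota p (fun _ : I => K) i₀ π ∈ normalizedPacket p (fun _ : I => K) := by
  rw [iota_eq_purePacket]
  refine integerPacket_le_normalizedPacket p _ (purePacket_mem_integerPacket p _ fun i => ?_)
  by_cases h : i = i₀
  · subst h; rw [Pi.mulSingle_eq_same]; exact (norm_pi_lt_one hπ).le
  · rw [Pi.mulSingle_eq_of_ne h, norm_one]

/-- `ι_{i₀}(π)·(ι_{i₀}(π)·m) = p·m`. [cite: Mochizuki2012, IUTchIV Prop. 1.1 p. 9] -/
theorem iota_pi_mul_iota_pi_mul (hπ : π ^ 2 = (p : K)) (i₀ : I) (m : PacketAlgebra p (fun _ : I => K)) :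
    iota p (fun _ : I => K) i₀ π * (iota p (fun _ : I => K) i₀ π * m) = (p : ℚ_[p]) • m := by
  rw [← mul_assoc, ← map_mul, ← sq, hπ, map_natCast, Algebra.smul_def, map_natCast]

/-- **`z = m₀ + ι_{i₀}(π)·m₁ ∈ (R_I)^∼` (`m₀, m₁ ∈ L_{i₀}`) forces `m₀ ∈ (R_I)^∼` and `ι_{i₀}(π)·m₁ ∈ (R_I)^∼`** for `p` ODD:
the conjugation `τ` at the slot `i₀` preserves `(R_I)^∼` and sends `z` to `m₀ − ι_{i₀}(π)·m₁`; `‖2‖ = 1`.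
[cite: Mochizuki2012, IUTchIV Prop. 1.1 p. 9] [cite: NeukirchANT1999, Ch. II (5.5)] -/
theorem mem_normalizedPacket_decomp [IsUltrametricDist K] (hp : p ≠ 2) (hK : Module.finrank ℚ_[p] K = 2)
    (hπ : π ^ 2 = (p : K)) (i₀ : I) {m₀ m₁ : PacketAlgebra p (fun _ : I => K)}
    (hm₀ : m₀ ∈ Submodule.span ℚ_[p]
      {t : PacketAlgebra p (fun _ : I => K) | ∃ x : I → K, x i₀ = 1 ∧ t = purePacket p (fun _ : I => K) x})
    (hm₁ : m₁ ∈ Submodule.span ℚ_[p]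
      {t : PacketAlgebra p (fun _ : I => K) | ∃ x : I → K, x i₀ = 1 ∧ t = purePacket p (fun _ : I => K) x})
    (hz : m₀ + iota p (fun _ : I => K) i₀ π * m₁ ∈ normalizedPacket p (fun _ : I => K)) :
    m₀ ∈ normalizedPacket p (fun _ : I => K) ∧ iota p (fun _ : I => K) i₀ π * m₁ ∈ normalizedPacket p (fun _ : I => K) := by
  haveI : Nonempty I := ⟨i₀⟩
  obtain ⟨B, hB0, hB1⟩ := exists_basis hK hπ
  obtain ⟨h10, h11, hπ0, hπ1⟩ := repr_one_pi B hB0 hB1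
  obtain ⟨τ, hτ1, hτπ, hτmul, hτiso⟩ := exists_conj hK hπ
  set g : ∀ _ : I, K ≃ₗ[ℚ_[p]] K := update (fun _ : I => LinearEquiv.refl ℚ_[p] K) i₀ τ with hg
  have hg1 : ∀ i, g i 1 = 1 := fun i => by
    by_cases h : i = i₀
    · subst h; rw [hg, update_self, hτ1]
    · rw [hg, update_of_ne h]; rfl
  have hgmul : ∀ i x y, g i (x * y) = g i x * g i y := fun i x y => by
    by_cases h : i = i₀
    · subst h; rw [hg, update_self, hτmul]
    · rw [hg, update_of_ne h]; rfl
  have hgiso : ∀ i x, ‖g i x‖ = ‖x‖ := fun i x => by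
    by_cases h : i = i₀
    · subst h; rw [hg, update_self, hτiso]
    · rw [hg, update_of_ne h]; rfl
  have hτz := congr_mem_normalizedPacket_of_mul g hg1 hgmul hgiso hz
  rw [map_add, hg, congr_update_of_mem_span B hB0 hB1 i₀ τ hm₀, congr_update_iota_mul_of_mem_span B hB0 hB1 i₀ τ hm₁,
    hτ1, hτπ, map_neg, h10, h11, Finsupp.coe_neg, Pi.neg_apply, Pi.neg_apply, hπ0, hπ1, one_smul, zero_smul, add_zero,
    neg_zero, zero_smul, zero_add, neg_one_smul] at hτz
  have h2' : ‖(2 : ℚ_[p])‖ = 1 := by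
    have h := (Padic.norm_natCast_eq_one_iff (p := p) (n := 2)).mpr
      ((Nat.coprime_primes (Fact.out : p.Prime) Nat.prime_two).mpr hp)
    simpa using h
  have h2 : ‖(2 : ℚ_[p])⁻¹‖ ≤ 1 := by rw [norm_inv, h2', inv_one]
  constructor
  · have hsum := add_mem hz hτz
    rw [show m₀ + iota p (fun _ : I => K) i₀ π * m₁ + (m₀ + -(iota p (fun _ : I => K) i₀ π * m₁)) = (2 : ℚ_[p]) • m₀ by
      rw [two_smul]; abel] at hsum
    have h := smul_mem_normalizedPacket h2 hsum
    rwa [smul_smul, inv_mul_cancel₀ (two_ne_zero), one_smul] at h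
  · have hdiff := sub_mem hz hτz
    rw [show m₀ + iota p (fun _ : I => K) i₀ π * m₁ - (m₀ + -(iota p (fun _ : I => K) i₀ π * m₁)) =
      (2 : ℚ_[p]) • (iota p (fun _ : I => K) i₀ π * m₁) by rw [two_smul]; abel] at hdiff
    have h := smul_mem_normalizedPacket h2 hdiff
    rwa [smul_smul, inv_mul_cancel₀ (two_ne_zero), one_smul] at h

/-! ## Isometries at one slot, then at every slot -/

/-- **An ISOMETRY `σ` at ONE slot maps `(R_I)^∼` into itself** (`p` odd): on `z = m₀ + ι(π)·m₁`,
`(⊗ g)(z) = (a·m₀ + c·m₁) + ι(π)·(b·m₀ + d·m₁)` with `‖a‖, ‖b‖, ‖d‖ ≤ 1` and `c·m₁ = (c/p)·ι(π)·(ι(π)·m₁)`, `c/p ∈ ℤ_p`.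
[cite: Mochizuki2012, IUTchIV Prop. 1.1 p. 9] [cite: NeukirchANT1999, Ch. II (5.5)] -/
theorem congr_update_mem_normalizedPacket [IsUltrametricDist K] (hp : p ≠ 2) (hK : Module.finrank ℚ_[p] K = 2)
    (hπ : π ^ 2 = (p : K)) (i₀ : I) (σ : K ≃ₗ[ℚ_[p]] K) (hσ : ∀ x, ‖σ x‖ = ‖x‖)
    {z : PacketAlgebra p (fun _ : I => K)} (hz : z ∈ normalizedPacket p (fun _ : I => K)) :
    (PiTensorProduct.congr (update (fun _ : I => LinearEquiv.refl ℚ_[p] K) i₀ σ) :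
        PacketAlgebra p (fun _ : I => K) ≃ₗ[ℚ_[p]] PacketAlgebra p (fun _ : I => K)) z ∈
      normalizedPacket p (fun _ : I => K) := by
  haveI : Nonempty I := ⟨i₀⟩
  obtain ⟨B, hB0, hB1⟩ := exists_basis hK hπ
  obtain ⟨ha, hb, hc, hd⟩ := isometry_coeff_bounds B hπ hB0 hB1 σ hσ
  obtain ⟨m₀, m₁, hm₀, hm₁, rfl⟩ := exists_decomp B hB0 hB1 i₀ z
  obtain ⟨hm₀', hm₁'⟩ := mem_normalizedPacket_decomp hp hK hπ i₀ hm₀ hm₁ hz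
  obtain ⟨c', hc', hcc'⟩ := exists_eq_p_mul_of_norm_le_norm_pi hπ hc
  rw [map_add, congr_update_of_mem_span B hB0 hB1 i₀ σ hm₀, congr_update_iota_mul_of_mem_span B hB0 hB1 i₀ σ hm₁]
  refine add_mem (add_mem (smul_mem_normalizedPacket ha hm₀') ?_) (add_mem ?_ (smul_mem_normalizedPacket hd hm₁'))
  · refine smul_mem_normalizedPacket (padicNorm_le_one_of_mul_norm_pi_le hπ hb) ?_
    exact mul_mem (iota_pi_mem_normalizedPacket hπ i₀) hm₀'
  · rw [hcc', mul_comm, ← smul_smul, ← iota_pi_mul_iota_pi_mul hπ i₀]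
    exact smul_mem_normalizedPacket hc' (mul_mem (iota_pi_mem_normalizedPacket hπ i₀) hm₁')

/-- Composition over slots: `⊗ (f on s ∪ {a}) = (⊗ update 1 a (f a)) ∘ (⊗ (f on s))` for `a ∉ s`.
[cite: Mochizuki2012, IUTchIV Prop. 1.1 p. 9] -/
theorem congr_insert_apply (f : ∀ _ : I, K ≃ₗ[ℚ_[p]] K) {s : Finset I} {a : I} (ha : a ∉ s)
    (z : PacketAlgebra p (fun _ : I => K)) :
    (PiTensorProduct.congr (fun i => if i ∈ insert a s then f i else LinearEquiv.refl ℚ_[p] K) :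
        PacketAlgebra p (fun _ : I => K) ≃ₗ[ℚ_[p]] PacketAlgebra p (fun _ : I => K)) z =
      (PiTensorProduct.congr (update (fun _ : I => LinearEquiv.refl ℚ_[p] K) a (f a)) :
          PacketAlgebra p (fun _ : I => K) ≃ₗ[ℚ_[p]] PacketAlgebra p (fun _ : I => K))
        ((PiTensorProduct.congr (fun i => if i ∈ s then f i else LinearEquiv.refl ℚ_[p] K) :
            PacketAlgebra p (fun _ : I => K) ≃ₗ[ℚ_[p]] PacketAlgebra p (fun _ : I => K)) z) := by
  induction z using PiTensorProduct.induction_on with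
  | smul_tprod r x =>
    rw [map_smul, map_smul, map_smul, PiTensorProduct.congr_tprod, PiTensorProduct.congr_tprod,
      PiTensorProduct.congr_tprod]
    congr 2
    funext i
    by_cases h : i = a
    · subst h
      rw [update_self, if_pos (Finset.mem_insert_self _ _), if_neg ha]; rfl
    · rw [update_of_ne h]
      by_cases hs : i ∈ s
      · rw [if_pos (Finset.mem_insert_of_mem hs), if_pos hs]; rfl
      · rw [if_neg (fun h' => (Finset.mem_insert.mp h').elim h hs), if_neg hs]; rfl
  | add x y hx hy => rw [map_add, map_add, map_add, hx, hy]

/-- The empty partial family acts as the identity. [cite: Mochizuki2012, IUTchIV Prop. 1.1 p. 9] -/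
theorem congr_ite_empty_apply (f : ∀ _ : I, K ≃ₗ[ℚ_[p]] K) (w : PacketAlgebra p (fun _ : I => K)) :
    (PiTensorProduct.congr (fun i => if i ∈ (∅ : Finset I) then f i else LinearEquiv.refl ℚ_[p] K) :
        PacketAlgebra p (fun _ : I => K) ≃ₗ[ℚ_[p]] PacketAlgebra p (fun _ : I => K)) w = w := by
  induction w using PiTensorProduct.induction_on with
  | smul_tprod r x => rw [map_smul, PiTensorProduct.congr_tprod]; rfl
  | add x y hx hy => rw [map_add, hx, hy]

/-- **ISOMETRIES FIX THE MAXIMAL ORDER OF EVERY TAME QUADRATIC PACKET.**  `p` odd, `[K : ℚ_p] = 2`, `π² = p`, any finite `I`: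
for every family `(f_i)_{i∈I}` of `ℚ_p`-linear isometries of `K` and every `z ∈ (R_I)^∼ ⊆ ⊗_{i∈I} K`, `(⊗ f_i)(z) ∈ (R_I)^∼`.
[cite: Mochizuki2012, IUTchIV Prop. 1.1 p. 9] [cite: NeukirchANT1999, Ch. II (5.5)] -/
theorem congr_mem_normalizedPacket_of_isometries [Fintype I] [IsUltrametricDist K] [Nonempty I] (hp : p ≠ 2)
    (hK : Module.finrank ℚ_[p] K = 2) (hπ : π ^ 2 = (p : K)) (f : ∀ _ : I, K ≃ₗ[ℚ_[p]] K) (hf : ∀ i x, ‖f i x‖ = ‖x‖)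
    {z : PacketAlgebra p (fun _ : I => K)} (hz : z ∈ normalizedPacket p (fun _ : I => K)) :
    (PiTensorProduct.congr f : PacketAlgebra p (fun _ : I => K) ≃ₗ[ℚ_[p]] PacketAlgebra p (fun _ : I => K)) z ∈
      normalizedPacket p (fun _ : I => K) := by
  have key : ∀ s : Finset I, ∀ w ∈ normalizedPacket p (fun _ : I => K),
      (PiTensorProduct.congr (fun i => if i ∈ s then f i else LinearEquiv.refl ℚ_[p] K) :
        PacketAlgebra p (fun _ : I => K) ≃ₗ[ℚ_[p]] PacketAlgebra p (fun _ : I => K)) w ∈ normalizedPacket p (fun _ : I => K) := by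
    intro s
    induction s using Finset.induction_on with
    | empty =>
      intro w hw
      rwa [congr_ite_empty_apply]
    | insert a s ha ih =>
      intro w hw
      rw [congr_insert_apply f ha]
      exact congr_update_mem_normalizedPacket hp hK hπ a (f a) (hf a) (ih w hw)
  have h := key Finset.univ z hz
  have hf' : (fun i => if i ∈ (Finset.univ : Finset I) then f i else LinearEquiv.refl ℚ_[p] K) = f := by
    funext i; rw [if_pos (Finset.mem_univ i)]
  rwa [hf'] at h

/-- **… and ONTO itself: `(⊗ f_i)((R_I)^∼) = (R_I)^∼`.** [cite: Mochizuki2012, IUTchIV Prop. 1.1 p. 9] -/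
theorem congr_image_normalizedPacket_eq_of_isometries [Fintype I] [IsUltrametricDist K] [Nonempty I] (hp : p ≠ 2)
    (hK : Module.finrank ℚ_[p] K = 2) (hπ : π ^ 2 = (p : K)) (f : ∀ _ : I, K ≃ₗ[ℚ_[p]] K) (hf : ∀ i x, ‖f i x‖ = ‖x‖) :
    (PiTensorProduct.congr f : PacketAlgebra p (fun _ : I => K) ≃ₗ[ℚ_[p]] PacketAlgebra p (fun _ : I => K)) ''
        (normalizedPacket p (fun _ : I => K) : Set (PacketAlgebra p (fun _ : I => K))) =
      (normalizedPacket p (fun _ : I => K) : Set (PacketAlgebra p (fun _ : I => K))) := by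
  have hf' : ∀ i x, ‖(f i).symm x‖ = ‖x‖ := fun i x => by
    conv_rhs => rw [← (f i).apply_symm_apply x]
    rw [hf]
  have hinv : ∀ w, (PiTensorProduct.congr f : PacketAlgebra p (fun _ : I => K) ≃ₗ[ℚ_[p]] PacketAlgebra p (fun _ : I => K))
      ((PiTensorProduct.congr (fun i => (f i).symm) :
        PacketAlgebra p (fun _ : I => K) ≃ₗ[ℚ_[p]] PacketAlgebra p (fun _ : I => K)) w) = w := fun w => by
    induction w using PiTensorProduct.induction_on with
    | smul_tprod r x =>
      rw [map_smul, map_smul, PiTensorProduct.congr_tprod, PiTensorProduct.congr_tprod]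
      congr 2; funext i; exact (f i).apply_symm_apply (x i)
    | add x y hx hy => rw [map_add, map_add, hx, hy]
  apply Set.Subset.antisymm
  · rintro _ ⟨z, hz, rfl⟩
    exact congr_mem_normalizedPacket_of_isometries hp hK hπ f hf hz
  · intro w hw
    exact ⟨_, congr_mem_normalizedPacket_of_isometries hp hK hπ (fun i => (f i).symm) hf' hw, hinv w⟩

/-- **NO ISOMETRIC MAXIMAL-ORDER MOVER AT ANY TAME QUADRATIC PACKET** (`p` odd, any number of factors).
[cite: Mochizuki2012, IUTchIV Prop. 1.1 p. 9] -/
theorem not_exists_isometry_mover_packet [Fintype I] [IsUltrametricDist K] [Nonempty I] (hp : p ≠ 2)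
    (hK : Module.finrank ℚ_[p] K = 2) (hπ : π ^ 2 = (p : K)) :
    ¬ ∃ (f : ∀ _ : I, K ≃ₗ[ℚ_[p]] K) (_ : ∀ i x, ‖f i x‖ = ‖x‖) (z : PacketAlgebra p (fun _ : I => K)),
      z ∈ (normalizedPacket p (fun _ : I => K) : Set (PacketAlgebra p (fun _ : I => K))) ∧
        (PiTensorProduct.congr f : PacketAlgebra p (fun _ : I => K) ≃ₗ[ℚ_[p]] PacketAlgebra p (fun _ : I => K)) z ∉
          (normalizedPacket p (fun _ : I => K) : Set (PacketAlgebra p (fun _ : I => K))) := by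
  rintro ⟨f, hf, z, hz, hnot⟩
  exact hnot (congr_mem_normalizedPacket_of_isometries hp hK hπ f hf hz)

end TameQuadratic

/-! ## Non-vacuity: `ℚ_p(√p) ⊆ ℚ̄_p`, `p` odd, any number of factors -/

/-- **NON-VACUITY: AT `ℚ_p(√p)`, `p` ODD, FACTORWISE ISOMETRIES FIX THE MAXIMAL ORDER OF `E^{⊗ I}` FOR EVERY FINITE `I`.**
[cite: Mochizuki2012, IUTchIV Prop. 1.1 p. 9] [cite: NeukirchANT1999, Ch. II (5.5)] -/
theorem exists_tameQuadratic_packet_isometry_stable (p : ℕ) [Fact p.Prime] (hp : p ≠ 2) (I : Type) [Fintype I]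
    [DecidableEq I] [Nonempty I] :
    ∃ (E : IntermediateField ℚ_[p] (PadicAlgCl p)) (_ : FiniteDimensional ℚ_[p] E), Module.finrank ℚ_[p] E = 2 ∧
      ∀ (f : ∀ _ : I, (E : Type) ≃ₗ[ℚ_[p]] E), (∀ i x, ‖f i x‖ = ‖x‖) →
        (PiTensorProduct.congr f :
            PacketAlgebra p (fun _ : I => (E : Type)) ≃ₗ[ℚ_[p]] PacketAlgebra p (fun _ : I => (E : Type))) ''
            (normalizedPacket p (fun _ : I => (E : Type)) : Set (PacketAlgebra p (fun _ : I => (E : Type)))) =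
          (normalizedPacket p (fun _ : I => (E : Type)) : Set (PacketAlgebra p (fun _ : I => (E : Type)))) := by
  obtain ⟨E, π, hfd, hK, hπ⟩ := TameQuadratic.exists_subfield p
  exact ⟨E, hfd, hK, fun f hf => TameQuadratic.congr_image_normalizedPacket_eq_of_isometries (K := E) hp hK hπ f hf⟩

end Literature.IUT.LogVolume

end
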